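import Summits.CriticalPhenomena.PercolationContinuityZ3.Theorems.Transplant.TwoAxisParaCellsRun
import HarnessLib

/-!
# N1 ({±1} node), kit adapter part 2, file 1 (hp-8 g33): QUASI-STEPS and the EXIT FRAME of a linear form — the window maps of the N1 face steps and
# stride chains have no unit steps, but every unit move of the frame `(x_b, ⌊(λ + s)/U⌋)` (one RAW planar coordinate, one floor level of a linear form
# `λ = c_α·α + c_β·β`) is realised by a `G`-path of length `≤ 3` whose inner vertices keep the frame value of the start (KIT-FRAMES-N1.md §3 (R1)/(R2))

builds on p205010 (kernel theorem, internal audit signed; external expert review pending) — nothing in this file uses p205010; nothing here is a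
claim about the open node `SamePDropOfSkeletonNeg`.
Lane `prim-bschramm`, seat `prim-hp-8` (gen 33; lead §10(b): kit adapter); helper file (`--supports stmt-CriticalPhenomena-4575 --as helper`).
WHY.  p1-g9's kit layer (`SkelPhiSeedSlab*`, `SkelPhiSlabRect`, `SkelPhiKits`) sites kits by EXACT unit walks of the window map (`Skelφ.Steps`);
the N1 window maps (run frames, face frames) are floor levels of sheared linear forms and have none.  With the raw axis `b := argmin(|c_α|,|c_β|)`,
the inward axis `a := oth b` and a unit `|c_α| + |c_β| ≤ U ≤ 3·|c_a|`: a TANGENTIAL unit move (`x_b ± 1`, level fixed) is one `e_b`-edge, preceded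
when the residue would leave `[0, U)` by ONE corrective `e_a`-edge whose endpoint has the SAME frame value; an INWARD unit move (level `± 1`,
`x_b` fixed) is `k ≤ 3` consecutive `e_a`-edges, the first `k − 1` endpoints at the start value.  So the frame has **`Skelφ.QSteps`** (every unit
move through a `Link3`), is 1-Lipschitz and reads φ-displacements without loss; footprint statements of the kit layer survive verbatim under
`QSteps`, lengths triple; `Steps ⇒ QSteps` (D″ = one edge).
* §1 (pure `ℤ`) `coarse_one_add`, **`level_tangential`**, **`level_inward`**; §2 `Skelφ.linForm/coef`, **`Skelφ.exitFrame φ t I b cα cβ U s`**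
  (index `I` ↦ level, `oth I` ↦ raw `b`), `lip_exitFrame`, `exitFrame_disp`; §3 `Link3`, `QSteps`, `qSteps_of_steps`, `Link3.mem_graphBall`,
  **`exitFrame_tangential`**, **`exitFrame_inward`**, **`qSteps_exitFrame`**.  Instances (separately, on the design owner's ruling): u-faces/x-runs
  `λ = A′(nβ − hα)`, `b = α` iff `|h| ≤ n`; v-faces `λ = A′(v_β α − v_α β)`, `b = β` iff `|v_α| ≤ |v_β|`; `U` = the cell's fine unit.
[cite: KozmaNitzan2024, §4 Lemma 10 Step III (p. 19), p. 21 (the shift of v(P) along the face)] [cite: MartineauTassion2017, §4.3 (cells z₁u + z₂v + P)]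
-/

namespace Summit.CriticalPhenomena.PercolationContinuityZ3.Theorems.Transplant

open Literature.Probability.LatticeModels

namespace TwoAxis.Para

/-! ## §1 Floor levels of a linear form: the residue controls the moves -/

/-- **Floor levels move by the residue**: `⌊(t + x + s)/U⌋ = ⌊(t + s)/U⌋ + k` as soon as `k·U ≤ r + x < (k+1)·U` for the residue
`r = (t + s) mod U` (`0 < U`). [folklore] -/
theorem coarse_one_add {s U t x k : ℤ} (hU : 0 < U) (h1 : k * U ≤ (t + s) % U + x) (h2 : (t + s) % U + x < (k + 1) * U) :
    coarse 1 s U (t + x) = coarse 1 s U t + k := by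
  unfold coarse
  have e1 : 1 * (t + x) + s = (t + s) + x := by ring
  have e2 : 1 * t + s = t + s := by ring
  rw [e1, e2]
  have hd := Int.mul_ediv_add_emod (t + s) U
  apply le_antisymm
  · have hlt : (t + s + x) / U < (t + s) / U + k + 1 := by
      rw [Int.ediv_lt_iff_lt_mul hU]
      have e : ((t + s) / U + k + 1) * U = U * ((t + s) / U) + (k + 1) * U := by ring
      rw [e]; linarith
    omega
  · rw [Int.le_ediv_iff_mul_le hU]
    have e : ((t + s) / U + k) * U = U * ((t + s) / U) + k * U := by ring
    rw [e]; linarith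

/-- The residue lies in `[0, U)`. [folklore] -/
theorem residue_bounds {s U : ℤ} (hU : 0 < U) (t : ℤ) : 0 ≤ (t + s) % U ∧ (t + s) % U < U :=
  ⟨Int.emod_nonneg _ hU.ne', Int.emod_lt_of_pos _ hU⟩

/-- **TANGENTIAL MOVE**: adding the small increment `±c_b` either keeps the level, or — after first adding a corrective `±c_a` that itself keeps the
level — keeps the level (`|c_b| ≤ |c_a|`, `|c_a| + |c_b| ≤ U`). [this work] -/
theorem level_tangential {s U t ca cb : ℤ} (hU : 0 < U) (hab : |cb| ≤ |ca|) (hsum : |ca| + |cb| ≤ U) {d : ℤ} (hd : d = cb ∨ d = -cb) :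
    coarse 1 s U (t + d) = coarse 1 s U t ∨
      ∃ e, (e = ca ∨ e = -ca) ∧ coarse 1 s U (t + e) = coarse 1 s U t ∧ coarse 1 s U (t + e + d) = coarse 1 s U t := by
  obtain ⟨hr0, hrU⟩ := residue_bounds (s := s) hU t
  set r := (t + s) % U with hr
  have hdabs : |d| = |cb| := by rcases hd with rfl | rfl <;> simp
  have hca0 : 0 ≤ |ca| := abs_nonneg _
  by_cases h0 : 0 ≤ r + d ∧ r + d < U
  · left
    have := coarse_one_add (s := s) (t := t) (x := d) (k := 0) hU (by linarith [h0.1]) (by linarith [h0.2])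
    simpa using this
  · right
    rcases lt_or_ge (r + d) 0 with hneg | hge
    · -- the residue would drop below `0`: first add `|ca|`
      have hdneg : d < 0 := by linarith
      have hdd : |d| = -d := abs_of_neg hdneg
      refine ⟨|ca|, ?_, ?_, ?_⟩
      · rcases abs_choice ca with h | h
        · exact Or.inl h
        · exact Or.inr h
      · have := coarse_one_add (s := s) (t := t) (x := |ca|) (k := 0) hU (by linarith) (by linarith)
        simpa using this
      · rw [add_assoc]
        have := coarse_one_add (s := s) (t := t) (x := |ca| + d) (k := 0) hU (by linarith) (by linarith)
        simpa using this
    · -- the residue would reach `U`: first subtract `|ca|`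
      have hge' : U ≤ r + d := by
        by_contra h'; exact h0 ⟨hge, lt_of_not_ge h'⟩
      have hdpos : 0 < d := by linarith
      have hdd : |d| = d := abs_of_pos hdpos
      refine ⟨-|ca|, ?_, ?_, ?_⟩
      · rcases abs_choice ca with h | h
        · exact Or.inr (by rw [h])
        · exact Or.inl (by rw [h]; ring)
      · have := coarse_one_add (s := s) (t := t) (x := -|ca|) (k := 0) hU (by linarith) (by linarith)
        simpa using this
      · rw [add_assoc]
        have := coarse_one_add (s := s) (t := t) (x := -|ca| + d) (k := 0) hU (by linarith) (by linarith)
        simpa using this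

/-- **INWARD MOVE**: with `e := ±c_a` of the wanted sign, `k ≤ 3` additions of `e` raise (lower) the level by exactly one, the first `k − 1` of them
keeping it (`0 < |c_a|`, `|c_a| ≤ U ≤ 3·|c_a|`). [this work] -/
theorem level_inward {s U t ca : ℤ} (hU : 0 < U) (hca : 0 < |ca|) (hU3 : U ≤ 3 * |ca|) (haU : |ca| ≤ U) {σ : ℤ} (hσ : σ = 1 ∨ σ = -1) :
    ∃ e, (e = ca ∨ e = -ca) ∧
      (coarse 1 s U (t + e) = coarse 1 s U t + σ ∨
        (coarse 1 s U (t + e) = coarse 1 s U t ∧ coarse 1 s U (t + 2 * e) = coarse 1 s U t + σ) ∨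
        (coarse 1 s U (t + e) = coarse 1 s U t ∧ coarse 1 s U (t + 2 * e) = coarse 1 s U t ∧
          coarse 1 s U (t + 3 * e) = coarse 1 s U t + σ)) := by
  obtain ⟨hr0, hrU⟩ := residue_bounds (s := s) hU t
  set r := (t + s) % U with hr
  have h0 : ∀ x, 0 ≤ r + x → r + x < U → coarse 1 s U (t + x) = coarse 1 s U t := fun x h1 h2 => by
    have := coarse_one_add (s := s) (t := t) (x := x) (k := 0) hU (by linarith) (by linarith)
    simpa using this
  rcases hσ with rfl | rfl
  · -- raise the level: `e = |ca|`
    refine ⟨|ca|, ?_, ?_⟩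
    · rcases abs_choice ca with h | h
      · exact Or.inl h
      · exact Or.inr h
    have hup : ∀ x, U ≤ r + x → r + x < 2 * U → coarse 1 s U (t + x) = coarse 1 s U t + 1 := fun x h1 h2 =>
      coarse_one_add (s := s) (t := t) (x := x) (k := 1) hU (by linarith) (by linarith)
    by_cases h1 : U ≤ r + |ca|
    · exact Or.inl (hup _ h1 (by linarith))
    · by_cases h2 : U ≤ r + 2 * |ca|
      · exact Or.inr (Or.inl ⟨h0 _ (by linarith) (by linarith), hup _ h2 (by linarith)⟩)
      · exact Or.inr (Or.inr ⟨h0 _ (by linarith) (by linarith), h0 _ (by linarith) (by linarith), hup _ (by linarith) (by linarith)⟩)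
  · -- lower the level: `e = -|ca|`
    refine ⟨-|ca|, ?_, ?_⟩
    · rcases abs_choice ca with h | h
      · exact Or.inr (by rw [h])
      · exact Or.inl (by rw [h]; ring)
    have hdn : ∀ x, -U ≤ r + x → r + x < 0 → coarse 1 s U (t + x) = coarse 1 s U t + -1 := fun x h1 h2 =>
      coarse_one_add (s := s) (t := t) (x := x) (k := -1) hU (by linarith) (by linarith)
    by_cases h1 : r - |ca| < 0
    · exact Or.inl (by have := hdn (-|ca|) (by linarith) (by linarith); simpa using this)
    · by_cases h2 : r - 2 * |ca| < 0
      · refine Or.inr (Or.inl ⟨?_, ?_⟩)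
        · have := h0 (-|ca|) (by linarith) (by linarith); simpa using this
        · have := hdn (2 * -|ca|) (by linarith) (by linarith); simpa using this
      · refine Or.inr (Or.inr ⟨?_, ?_, ?_⟩)
        · have := h0 (-|ca|) (by linarith) (by linarith); simpa using this
        · have := h0 (2 * -|ca|) (by linarith) (by linarith); simpa using this
        · have := hdn (3 * -|ca|) (by linarith) (by linarith); simpa using this

end TwoAxis.Para

/-! ## §2 The exit frame of a linear form about a base vertex -/

namespace Skelφ

open Literature.Probability.Percolation.KozmaNitzan.Cells (oth oth_ne eq_oth_of_ne oth_oth)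
open Literature.Barriers.CriticalPhenomena (graphBall mem_graphBall_self graphBall_mono)
open TwoAxis.Para (coarse)

variable {V : Type} {G : SimpleGraph V} {φ : V → Site 2}

/-- A planar linear form `c_α·x₀ + c_β·x₁`. [folklore] -/
def linForm (cα cβ : ℤ) (x : Site 2) : ℤ := cα * x 0 + cβ * x 1

/-- Its coefficient along the axis `i`. [folklore] -/
def coef (cα cβ : ℤ) (i : Fin 2) : ℤ := if i = 0 then cα else cβ

/-- `linForm` along a unit step. [folklore] -/
theorem linForm_add_single (cα cβ : ℤ) (x : Site 2) (i : Fin 2) (σ : ℤ) :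
    linForm cα cβ (x + Pi.single i σ) = linForm cα cβ x + σ * coef cα cβ i := by
  fin_cases i <;> (simp [linForm, coef]; ring)

/-- `|c_α| + |c_β| = |coef b| + |coef (oth b)|`. [folklore] -/
theorem abs_coef_add (cα cβ : ℤ) (b : Fin 2) : |coef cα cβ b| + |coef cα cβ (oth b)| = |cα| + |cβ| := by
  fin_cases b
  · simp [coef, oth]
  · simp [coef, oth, add_comm]

/-- A 1-Lipschitz planar step moves `linForm` by at most `|c_α| + |c_β|`. [folklore] -/
theorem abs_linForm_sub_le (cα cβ : ℤ) {x y : Site 2} (h0 : |x 0 - y 0| ≤ 1) (h1 : |x 1 - y 1| ≤ 1) :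
    |linForm cα cβ x - linForm cα cβ y| ≤ |cα| + |cβ| := by
  have e : linForm cα cβ x - linForm cα cβ y = cα * (x 0 - y 0) + cβ * (x 1 - y 1) := by unfold linForm; ring
  rw [e]
  calc |cα * (x 0 - y 0) + cβ * (x 1 - y 1)| ≤ |cα * (x 0 - y 0)| + |cβ * (x 1 - y 1)| := abs_add_le _ _
    _ = |cα| * |x 0 - y 0| + |cβ| * |x 1 - y 1| := by rw [abs_mul, abs_mul]
    _ ≤ |cα| * 1 + |cβ| * 1 := by gcongr
    _ = |cα| + |cβ| := by ring

/-- A planar displacement of sup-size `≤ d` moves `linForm` by at most `d·(|c_α| + |c_β|)`. [folklore] -/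
theorem abs_linForm_sub_le_mul (cα cβ : ℤ) {x y : Site 2} {d : ℤ} (h0 : |x 0 - y 0| ≤ d) (h1 : |x 1 - y 1| ≤ d) :
    |linForm cα cβ x - linForm cα cβ y| ≤ d * (|cα| + |cβ|) := by
  have e : linForm cα cβ x - linForm cα cβ y = cα * (x 0 - y 0) + cβ * (x 1 - y 1) := by unfold linForm; ring
  rw [e]
  have hd : 0 ≤ d := (abs_nonneg _).trans h0
  calc |cα * (x 0 - y 0) + cβ * (x 1 - y 1)| ≤ |cα * (x 0 - y 0)| + |cβ * (x 1 - y 1)| := abs_add_le _ _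
    _ = |cα| * |x 0 - y 0| + |cβ| * |x 1 - y 1| := by rw [abs_mul, abs_mul]
    _ ≤ |cα| * d + |cβ| * d := by gcongr
    _ = d * (|cα| + |cβ|) := by ring

variable (φ) in
/-- **The exit frame** of the linear form `λ = c_α·α + c_β·β` about the base vertex `t`, exit index `I`, raw axis `b`, level unit `U`, offset `s`:
coordinate `I` is the floor level `⌊(λ(φ w − φ t) + s)/U⌋`, coordinate `oth I` is the raw relative coordinate `φ w b − φ t b`. [this work] -/
def exitFrame (t : V) (I b : Fin 2) (cα cβ U s : ℤ) : V → Site 2 := fun w i =>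
  if i = I then coarse 1 s U (linForm cα cβ (relφ φ t w)) else relφ φ t w b

/-- The level coordinate of the exit frame. [folklore] -/
theorem exitFrame_apply_self (t : V) (I b : Fin 2) (cα cβ U s : ℤ) (w : V) :
    exitFrame φ t I b cα cβ U s w I = coarse 1 s U (linForm cα cβ (relφ φ t w)) := by simp [exitFrame]

/-- The raw coordinate of the exit frame. [folklore] -/
theorem exitFrame_apply_oth (t : V) (I b : Fin 2) (cα cβ U s : ℤ) (w : V) :
    exitFrame φ t I b cα cβ U s w (oth I) = relφ φ t w b := by simp [exitFrame, oth_ne]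

/-- A unit step of `φ` along axis `i` with sign `σ` is a unit step of the relative position. [folklore] -/
theorem relφ_of_step {t v v' : V} {i : Fin 2} {σ : ℤ} (h : φ v' = φ v + Pi.single i σ) : relφ φ t v' = relφ φ t v + Pi.single i σ := by
  funext j; simp [relφ, h]; ring

/-- **The exit frame is 1-Lipschitz** as soon as `|c_α| + |c_β| ≤ U` (`0 < U`). [this work] -/
theorem lip_exitFrame (hlip : Lip G φ) (t : V) (I b : Fin 2) {cα cβ U : ℤ} (s : ℤ) (hU : 0 < U) (hsum : |cα| + |cβ| ≤ U) :
    Lip G (exitFrame φ t I b cα cβ U s) := by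
  intro u v huv i
  have h0 := lip_relφ hlip t huv 0
  have h1 := lip_relφ hlip t huv 1
  by_cases hi : i = I
  · subst hi
    rw [exitFrame_apply_self, exitFrame_apply_self]
    exact TwoAxis.Para.abs_coarse_sub_le_one (c := 1) (L := U) (by norm_num) hU (by linarith)
      ((abs_linForm_sub_le cα cβ h0 h1).trans hsum)
  · rw [eq_oth_of_ne hi, exitFrame_apply_oth, exitFrame_apply_oth]
    exact lip_relφ hlip t huv b

/-- **The exit frame reads φ-displacements without loss**: `|φ v − φ w|_∞ ≤ d` gives `|frame v − frame w|_∞ ≤ d` (`|c_α| + |c_β| ≤ U`, `0 < U`) — kit squares,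
zone boxes and slab cylinders measured in `φ` sit in frame boxes of the same radius. [this work] -/
theorem exitFrame_disp (t : V) (I b : Fin 2) {cα cβ U : ℤ} (s : ℤ) (hU : 0 < U) (hsum : |cα| + |cβ| ≤ U) {v w : V} {d : ℤ}
    (h : ∀ i, |φ v i - φ w i| ≤ d) : ∀ i, |exitFrame φ t I b cα cβ U s v i - exitFrame φ t I b cα cβ U s w i| ≤ d := by
  have hr : ∀ i, |relφ φ t v i - relφ φ t w i| ≤ d := fun i => by simpa [relφ] using h i
  have hd : 0 ≤ d := (abs_nonneg _).trans (h 0)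
  intro i
  by_cases hi : i = I
  · subst hi
    rw [exitFrame_apply_self, exitFrame_apply_self]
    refine TwoAxis.Para.abs_coarse_sub_le_of_mul hU ?_
    rw [← mul_sub, one_mul]
    exact (abs_linForm_sub_le_mul cα cβ (hr 0) (hr 1)).trans (mul_le_mul_of_nonneg_left hsum hd)
  · rw [eq_oth_of_ne hi, exitFrame_apply_oth, exitFrame_apply_oth]
    exact hr b

/-! ## §3 Quasi-steps: unit moves of the frame through short paths whose inner vertices keep the frame value -/

variable (G) in
/-- **A link of length `≤ 3` with inner vertices at the start value** of the planar map `F`: `w — w'`, or `w — m — w'` with `F m = F w`, or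
`w — m — m' — w'` with `F m = F m' = F w`. [this work] -/
def Link3 (F : V → Site 2) (w w' : V) : Prop :=
  G.Adj w w' ∨ (∃ m, G.Adj w m ∧ G.Adj m w' ∧ F m = F w) ∨ (∃ m m', G.Adj w m ∧ G.Adj m m' ∧ G.Adj m' w' ∧ F m = F w ∧ F m' = F w)

variable (G) in
/-- **Quasi-steps** of a planar map: every unit move in each of the four directions is realised by a `Link3`.  The replacement of `Skelφ.Steps` for the
N1 window maps. [this work] -/
def QSteps (F : V → Site 2) : Prop := ∀ (w : V) (i : Fin 2) (σ : ℤˣ), ∃ w', F w' = F w + Pi.single i (σ : ℤ) ∧ Link3 G F w w'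

/-- Unit steps are quasi-steps (D″ is the case of one edge). [folklore] -/
theorem qSteps_of_steps (hstep : Steps G φ) : QSteps G φ := fun w i σ => by
  obtain ⟨w', hadj, hφ⟩ := hstep w i σ
  exact ⟨w', hφ, Or.inl hadj⟩

/-- The far end of a `Link3` lies in the graph ball of radius `3`. [folklore] -/
theorem Link3.mem_graphBall {F : V → Site 2} {w w' : V} (h : Link3 G F w w') : w' ∈ graphBall G w 3 := by
  have h0 : w ∈ graphBall G w 0 := mem_graphBall_self G w 0
  rcases h with h | ⟨m, h1, h2, -⟩ | ⟨m, m', h1, h2, h3, -, -⟩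
  · exact graphBall_mono G w (by norm_num) (BoxProdZ2.mem_graphBall_succ_of_adj G h0 h)
  · exact graphBall_mono G w (by norm_num) (BoxProdZ2.mem_graphBall_succ_of_adj G (BoxProdZ2.mem_graphBall_succ_of_adj G h0 h1) h2)
  · exact BoxProdZ2.mem_graphBall_succ_of_adj G (BoxProdZ2.mem_graphBall_succ_of_adj G (BoxProdZ2.mem_graphBall_succ_of_adj G h0 h1) h2) h3

section Moves

variable (t : V) {I b : Fin 2} {cα cβ U s : ℤ}

/-- The frame value after a φ-step along the RAW axis `b` with sign `τ` from a vertex whose level is unchanged by the step. [folklore] -/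
theorem exitFrame_of_step_raw {v v' : V} {τ : ℤ} (h : φ v' = φ v + Pi.single b τ)
    (hlev : coarse 1 s U (linForm cα cβ (relφ φ t v) + τ * coef cα cβ b) = coarse 1 s U (linForm cα cβ (relφ φ t v))) :
    exitFrame φ t I b cα cβ U s v' = exitFrame φ t I b cα cβ U s v + Pi.single (oth I) τ := by
  have hr := relφ_of_step (t := t) h
  funext i
  by_cases hi : i = I
  · subst hi
    rw [Pi.add_apply, exitFrame_apply_self, exitFrame_apply_self, hr, linForm_add_single, hlev, Pi.single_eq_of_ne (oth_ne i).symm, add_zero]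
  · rw [eq_oth_of_ne hi, Pi.add_apply, exitFrame_apply_oth, exitFrame_apply_oth, hr, Pi.single_eq_same, Pi.add_apply, Pi.single_eq_same]

/-- The frame value is unchanged by a φ-step along the INWARD axis `oth b` that keeps the level. [folklore] -/
theorem exitFrame_of_step_inward {v v' : V} {σ : ℤ} (h : φ v' = φ v + Pi.single (oth b) σ)
    (hlev : coarse 1 s U (linForm cα cβ (relφ φ t v) + σ * coef cα cβ (oth b)) = coarse 1 s U (linForm cα cβ (relφ φ t v)) + 0) :
    exitFrame φ t I b cα cβ U s v' = exitFrame φ t I b cα cβ U s v := by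
  have hr := relφ_of_step (t := t) h
  funext i
  by_cases hi : i = I
  · subst hi
    rw [exitFrame_apply_self, exitFrame_apply_self, hr, linForm_add_single, hlev, add_zero]
  · rw [eq_oth_of_ne hi, exitFrame_apply_oth, exitFrame_apply_oth, hr, Pi.add_apply, Pi.single_eq_of_ne (oth_ne b).symm, add_zero]

/-- The frame value after a φ-step along the inward axis that changes the level by `k`. [folklore] -/
theorem exitFrame_of_step_inward' {v v' : V} {σ k : ℤ} (h : φ v' = φ v + Pi.single (oth b) σ)
    (hlev : coarse 1 s U (linForm cα cβ (relφ φ t v) + σ * coef cα cβ (oth b)) = coarse 1 s U (linForm cα cβ (relφ φ t v)) + k) :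
    exitFrame φ t I b cα cβ U s v' = exitFrame φ t I b cα cβ U s v + Pi.single I k := by
  have hr := relφ_of_step (t := t) h
  funext i
  by_cases hi : i = I
  · subst hi
    rw [Pi.add_apply, exitFrame_apply_self, exitFrame_apply_self, hr, linForm_add_single, hlev, Pi.single_eq_same]
  · rw [eq_oth_of_ne hi, Pi.add_apply, exitFrame_apply_oth, exitFrame_apply_oth, hr, Pi.add_apply, Pi.single_eq_of_ne (oth_ne b).symm, add_zero,
      Pi.single_eq_of_ne (oth_ne _), add_zero]

variable (hstep : Steps G φ) (hU : 0 < U) (hsum : |cα| + |cβ| ≤ U)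
include hstep hU hsum

/-- **TANGENTIAL QUASI-STEP**: the raw coordinate moves by `τ = ±1` at fixed level through a `Link3` (one `e_b`-edge, possibly after one corrective
`e_a`-edge), provided `|c_b| ≤ |c_a|` (`a = oth b`) and `|c_α| + |c_β| ≤ U`. [this work] -/
theorem exitFrame_tangential (hab : |coef cα cβ b| ≤ |coef cα cβ (oth b)|) (w : V) (τ : ℤˣ) :
    ∃ w', exitFrame φ t I b cα cβ U s w' = exitFrame φ t I b cα cβ U s w + Pi.single (oth I) (τ : ℤ) ∧
      Link3 G (exitFrame φ t I b cα cβ U s) w w' := by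
  set L := linForm cα cβ (relφ φ t w) with hL
  have hsum' : |coef cα cβ (oth b)| + |coef cα cβ b| ≤ U := by rw [add_comm, abs_coef_add]; exact hsum
  have hd : (τ : ℤ) * coef cα cβ b = coef cα cβ b ∨ (τ : ℤ) * coef cα cβ b = -coef cα cβ b := by
    rcases Int.units_eq_one_or τ with h | h <;> simp [h]
  rcases TwoAxis.Para.level_tangential (s := s) (t := L) hU hab hsum' hd with hsame | ⟨e, he, h1, h2⟩
  · obtain ⟨w', hadj, hφ⟩ := hstep w b τ
    exact ⟨w', exitFrame_of_step_raw t hφ hsame, Or.inl hadj⟩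
  · -- `e = σ · c_a`: one corrective step along `a = oth b`, then the raw step
    have hσ : ∃ σ : ℤˣ, e = (σ : ℤ) * coef cα cβ (oth b) := by
      rcases he with rfl | rfl
      · exact ⟨1, by simp⟩
      · exact ⟨-1, by simp⟩
    obtain ⟨σ, rfl⟩ := hσ
    obtain ⟨m, hadj₁, hφ₁⟩ := hstep w (oth b) σ
    obtain ⟨w', hadj₂, hφ₂⟩ := hstep m b τ
    have hm : exitFrame φ t I b cα cβ U s m = exitFrame φ t I b cα cβ U s w :=
      exitFrame_of_step_inward t hφ₁ (by rw [add_zero]; exact h1)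
    have hLm : linForm cα cβ (relφ φ t m) = L + (σ : ℤ) * coef cα cβ (oth b) := by
      rw [relφ_of_step (t := t) hφ₁, linForm_add_single]
    refine ⟨w', ?_, Or.inr (Or.inl ⟨m, hadj₁, hadj₂, hm⟩)⟩
    rw [← hm]
    refine exitFrame_of_step_raw t hφ₂ ?_
    rw [hLm, h2, ← hLm]
    -- the level of `m` equals the level of `w`
    have := congrFun hm I
    rw [exitFrame_apply_self, exitFrame_apply_self] at this
    exact this.symm

/-- **INWARD QUASI-STEP**: the level moves by `σ = ±1` at fixed raw coordinate through a `Link3` (`≤ 3` edges along `a = oth b`), provided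
`0 < |c_a|`, `U ≤ 3·|c_a|` and `|c_α| + |c_β| ≤ U`. [this work] -/
theorem exitFrame_inward (hca : 0 < |coef cα cβ (oth b)|) (hU3 : U ≤ 3 * |coef cα cβ (oth b)|) (w : V) (σ : ℤˣ) :
    ∃ w', exitFrame φ t I b cα cβ U s w' = exitFrame φ t I b cα cβ U s w + Pi.single I (σ : ℤ) ∧
      Link3 G (exitFrame φ t I b cα cβ U s) w w' := by
  set L := linForm cα cβ (relφ φ t w) with hL
  have haU : |coef cα cβ (oth b)| ≤ U := by
    have := abs_coef_add cα cβ b; have := abs_nonneg (coef cα cβ b); linarith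
  have hσ : (σ : ℤ) = 1 ∨ (σ : ℤ) = -1 := by rcases Int.units_eq_one_or σ with h | h <;> simp [h]
  obtain ⟨e, he, hcases⟩ := TwoAxis.Para.level_inward (s := s) (t := L) hU hca hU3 haU hσ
  have hρ : ∃ ρ : ℤˣ, e = (ρ : ℤ) * coef cα cβ (oth b) := by
    rcases he with rfl | rfl
    · exact ⟨1, by simp⟩
    · exact ⟨-1, by simp⟩
  obtain ⟨ρ, rfl⟩ := hρ
  -- three consecutive steps along `a` (we use as many as needed)
  obtain ⟨m₁, ha₁, hφ₁⟩ := hstep w (oth b) ρ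
  obtain ⟨m₂, ha₂, hφ₂⟩ := hstep m₁ (oth b) ρ
  obtain ⟨m₃, ha₃, hφ₃⟩ := hstep m₂ (oth b) ρ
  have hL₁ : linForm cα cβ (relφ φ t m₁) = L + (ρ : ℤ) * coef cα cβ (oth b) := by
    rw [relφ_of_step (t := t) hφ₁, linForm_add_single]
  have hL₂ : linForm cα cβ (relφ φ t m₂) = L + 2 * ((ρ : ℤ) * coef cα cβ (oth b)) := by
    rw [relφ_of_step (t := t) hφ₂, linForm_add_single, hL₁]; ring
  have e2 : L + (ρ : ℤ) * coef cα cβ (oth b) + (ρ : ℤ) * coef cα cβ (oth b) = L + 2 * ((ρ : ℤ) * coef cα cβ (oth b)) := by ring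
  have e3 : L + 2 * ((ρ : ℤ) * coef cα cβ (oth b)) + (ρ : ℤ) * coef cα cβ (oth b) = L + 3 * ((ρ : ℤ) * coef cα cβ (oth b)) := by ring
  rcases hcases with h1 | ⟨h1, h2⟩ | ⟨h1, h2, h3⟩
  · exact ⟨m₁, exitFrame_of_step_inward' t hφ₁ h1, Or.inl ha₁⟩
  · have hm₁ : exitFrame φ t I b cα cβ U s m₁ = exitFrame φ t I b cα cβ U s w :=
      exitFrame_of_step_inward t hφ₁ (by rw [add_zero]; exact h1)
    refine ⟨m₂, ?_, Or.inr (Or.inl ⟨m₁, ha₁, ha₂, hm₁⟩)⟩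
    rw [← hm₁]
    refine exitFrame_of_step_inward' t hφ₂ ?_
    rw [hL₁, e2, h2, ← h1, ← hL₁]
  · have hm₁ : exitFrame φ t I b cα cβ U s m₁ = exitFrame φ t I b cα cβ U s w :=
      exitFrame_of_step_inward t hφ₁ (by rw [add_zero]; exact h1)
    have hm₂ : exitFrame φ t I b cα cβ U s m₂ = exitFrame φ t I b cα cβ U s m₁ := by
      refine exitFrame_of_step_inward t hφ₂ ?_
      rw [hL₁, e2, h2, add_zero, ← h1, ← hL₁]
    refine ⟨m₃, ?_, Or.inr (Or.inr ⟨m₁, m₂, ha₁, ha₂, ha₃, hm₁, hm₂.trans hm₁⟩)⟩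
    rw [← hm₁, ← hm₂]
    refine exitFrame_of_step_inward' t hφ₃ ?_
    rw [hL₂, e3, h3, ← h2, ← hL₂]

/-- **THE EXIT FRAME HAS QUASI-STEPS**: with the raw axis `b` the smaller coefficient (`|c_b| ≤ |c_a|`, `0 < |c_a|`, `a = oth b`) and a level unit
`|c_α| + |c_β| ≤ U ≤ 3·|c_a|`, every unit move of `exitFrame φ t I b cα cβ U s` is a `Link3`. [this work] -/
theorem qSteps_exitFrame (hab : |coef cα cβ b| ≤ |coef cα cβ (oth b)|) (hca : 0 < |coef cα cβ (oth b)|)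
    (hU3 : U ≤ 3 * |coef cα cβ (oth b)|) : QSteps G (exitFrame φ t I b cα cβ U s) := by
  intro w i σ
  by_cases hi : i = I
  · subst hi; exact exitFrame_inward t hstep hU hsum hca hU3 w σ
  · rw [eq_oth_of_ne hi]; exact exitFrame_tangential t hstep hU hsum hab w σ

end Moves

end Skelφ

end Summit.CriticalPhenomena.PercolationContinuityZ3.Theorems.Transplant
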